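import Summits.AtomisticToContinuum.HydrodynamicLimit.Theorems.InformationPercolationEngineCollisionRate
import Summits.AtomisticToContinuum.HydrodynamicLimit.Theorems.OneFlightGossipEngineCollisionActivityTailsAbnormalActivityStatics
import Literature.MathematicalPhysics.KineticTheory.CollisionFluxMeanBoundNonStationary
import Literature.MathematicalPhysics.KineticTheory.ShortFlightCount
import HarnessLib

/-!
# `InformationPercolationEngine.CollisionRate` (stmt-AtomisticToContinuum-13481), line `Sketch`, stub F3: the forward-contact
collision-flux bound under the EVOLVED local Gibbs law, from the marginal envelope (A)

Helper file (`--supports stmt-AtomisticToContinuum-13481`), registered stub `stub_fwdHitFluxLG_of_envelope`: the general-profile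
twin of the rung-0 window bound `localGibbsLaw_fwdHitCollisionSum_ge_le` (`Literature…KineticTheory.ShortFlightCount`) — at a
collision `(s, i, j)` the mark counts the third particles `j' ∉ {i, j}` on a free collision course with `i` within time `ℓ`.
The port replaces (i) stationarity by the non-stationary window device `exists_measurable_majorant_collisionSum_of_forall_le` on
`[0, τ']` plus Markov for the measurable majorant, the one-window bound under every law `(Φ_r)_* LG`, `r ∈ [0, τ']`, coming from
`lintegral_map_le` and the TRIPLE conjunct of (A) (the functional at fixed `(i, j, j')` depends on `(w i, w j, w j')` only);
(ii) the three-label `posGibbs` bound by the exact computation on `(vol ⊗ γ)^{⊗ 3}` (`measure_tripleLiftEvent_le`: for fixed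
`(x_i, v_i)` the two lift events are independent; `volume_setOf_exists_reprSym_add_latticeVec_mem_le`; `(∫‖v_i − v‖dγ)² ≤ 2∫‖v_i − v‖²dγ`).
The mesh cancels in the `liminf` (`liminf_le_of_frequently_le'` along `M ≥ τ'/ℓ`); the constant of the conclusion is `64 C_A`.
References: Cercignani–Illner–Pulvirenti, *The Mathematical Theory of Dilute Gases* (1994), §4.3, App. 4.A;
Gallagher–Saint-Raymond–Texier, *From Newton to Boltzmann* (2013), Prop. 4.1.1.
-/


open scoped BigOperators Topology Classical MeasureTheory ProbabilityTheory InnerProductSpace ENNReal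
open Filter Set Function MeasureTheory
open Literature.Analysis.FluidPDE Literature.MathematicalPhysics.KineticTheory

namespace Summit.AtomisticToContinuum.HydrodynamicLimit.Theorems.CollisionRate

open Literature.Analysis.FunctionSpaces (Torus.latticeVec Torus.proj)

/-- **A lift event under `vol ⊗ γ`.** For `y ∈ 𝕋³` and a jointly measurable family `T v ⊆ ℝ³`, the `vol ⊗ γ`-measure of
`{(x, v) | some lift of x − y lies in T v}` is at most `∫ vol (T v) dγ(v)` (Tonelli, then Haar versus Lebesgue through the
minimal image, `volume_setOf_exists_reprSym_add_latticeVec_mem_le`). -/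
theorem prod_liftEvent_le (γ : Measure V3) [SFinite γ] (y : T3) {T : V3 → Set V3} (hT : MeasurableSet {q : V3 × V3 | q.1 ∈ T q.2}) :
    ((volume : Measure T3).prod γ) {q : T3 × V3 | ∃ k : Fin 3 → ℤ, Torus.reprSym (q.1 - y) + Torus.latticeVec k ∈ T q.2} ≤
      ∫⁻ v, volume (T v) ∂γ := by
  have hm : MeasurableSet {q : T3 × V3 | ∃ k : Fin 3 → ℤ, Torus.reprSym (q.1 - y) + Torus.latticeVec k ∈ T q.2} := by
    convert MeasurableSet.iUnion fun k : Fin 3 → ℤ => hT.preimage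
      (((Torus.measurable_reprSym.comp (measurable_fst.sub_const y)).add_const (Torus.latticeVec k)).prodMk measurable_snd) using 1
    ext q; simp only [mem_setOf_eq, mem_iUnion, mem_preimage, Function.comp_apply]
  rw [Measure.prod_apply_symm hm]
  exact lintegral_mono fun v =>
    volume_setOf_exists_reprSym_add_latticeVec_mem_le y (hT.preimage (measurable_id.prodMk measurable_const))

/-- `(∫ ‖v₁ − v‖ dγ)² ≤ 2 ∫ ‖v₁ − v‖² dγ` for a probability measure `γ` (`ab ≤ a² + b²` inside the double integral). -/
theorem lintegral_norm_sub_mul_self_le (γ : Measure V3) [IsProbabilityMeasure γ] (v₁ : V3) :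
    (∫⁻ v, ENNReal.ofReal ‖v₁ - v‖ ∂γ) * (∫⁻ v, ENNReal.ofReal ‖v₁ - v‖ ∂γ) ≤ 2 * ∫⁻ v, ENNReal.ofReal (‖v₁ - v‖ ^ 2) ∂γ := by
  have hm : Measurable fun v : V3 => ENNReal.ofReal ‖v₁ - v‖ := by fun_prop
  have hm2 : Measurable fun v : V3 => ENNReal.ofReal (‖v₁ - v‖ ^ 2) := by fun_prop
  rw [← lintegral_lintegral_mul hm.aemeasurable hm.aemeasurable]
  calc ∫⁻ v, ∫⁻ w, ENNReal.ofReal ‖v₁ - v‖ * ENNReal.ofReal ‖v₁ - w‖ ∂γ ∂γ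
      ≤ ∫⁻ v, ∫⁻ w, (ENNReal.ofReal (‖v₁ - v‖ ^ 2) + ENNReal.ofReal (‖v₁ - w‖ ^ 2)) ∂γ ∂γ := by
        refine lintegral_mono fun v => lintegral_mono fun w => ?_
        rw [← ENNReal.ofReal_mul (norm_nonneg _), ← ENNReal.ofReal_add (sq_nonneg _) (sq_nonneg _)]
        exact ENNReal.ofReal_le_ofReal
          (by nlinarith [sq_nonneg (‖v₁ - v‖ - ‖v₁ - w‖), mul_nonneg (norm_nonneg (v₁ - v)) (norm_nonneg (v₁ - w))])
    _ = 2 * ∫⁻ v, ENNReal.ofReal (‖v₁ - v‖ ^ 2) ∂γ := by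
        simp_rw [lintegral_add_right _ hm2, lintegral_const, measure_univ, mul_one]
        rw [lintegral_add_left hm2, lintegral_const, measure_univ, mul_one, two_mul]

/-- The three-label lift event of `measure_tripleLiftEvent_le` is measurable (countable unions of preimages of the jointly
measurable tube families under measurable coordinate maps). -/
theorem measurableSet_tripleLiftEvent {Sh Sℓ : V3 → Set V3} (hShm : MeasurableSet {q : V3 × V3 | q.1 ∈ Sh q.2})
    (hSℓm : MeasurableSet {q : V3 × V3 | q.1 ∈ Sℓ q.2}) :
    MeasurableSet {q : (T3 × V3) × (T3 × V3) × (T3 × V3) |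
      (∃ k : Fin 3 → ℤ, Torus.reprSym (q.2.1.1 - q.1.1) + Torus.latticeVec k ∈ Sh (q.1.2 - q.2.1.2)) ∧
        ∃ k : Fin 3 → ℤ, Torus.reprSym (q.2.2.1 - q.1.1) + Torus.latticeVec k ∈ Sℓ (q.2.2.2 - q.1.2) ∪ Sh (q.1.2 - q.2.2.2)} := by
  have hψ : ∀ k : Fin 3 → ℤ, Measurable fun q : (T3 × V3) × (T3 × V3) × (T3 × V3) =>
      (Torus.reprSym (q.2.1.1 - q.1.1) + Torus.latticeVec k, q.1.2 - q.2.1.2) := fun k => ((Torus.measurable_reprSym.comp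
    (measurable_snd.fst.fst.sub measurable_fst.fst)).add_const _).prodMk (measurable_fst.snd.sub measurable_snd.fst.snd)
  have hψ' : ∀ k : Fin 3 → ℤ, Measurable fun q : (T3 × V3) × (T3 × V3) × (T3 × V3) =>
      (Torus.reprSym (q.2.2.1 - q.1.1) + Torus.latticeVec k, q.2.2.2 - q.1.2) := fun k => ((Torus.measurable_reprSym.comp
    (measurable_snd.snd.fst.sub measurable_fst.fst)).add_const _).prodMk (measurable_snd.snd.snd.sub measurable_fst.snd)
  have hψ'' : ∀ k : Fin 3 → ℤ, Measurable fun q : (T3 × V3) × (T3 × V3) × (T3 × V3) =>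
      (Torus.reprSym (q.2.2.1 - q.1.1) + Torus.latticeVec k, q.1.2 - q.2.2.2) := fun k => ((Torus.measurable_reprSym.comp
    (measurable_snd.snd.fst.sub measurable_fst.fst)).add_const _).prodMk (measurable_fst.snd.sub measurable_snd.snd.snd)
  convert (MeasurableSet.iUnion fun k => hShm.preimage (hψ k)).inter
    (MeasurableSet.iUnion fun k => (hSℓm.preimage (hψ' k)).union (hShm.preimage (hψ'' k))) using 1
  ext q; simp only [mem_setOf_eq, mem_inter_iff, mem_iUnion, mem_preimage, mem_union]

/-- **Three-label statics on the reference space (exact computation).** Under `(vol ⊗ γ)^{⊗ 3}`, `γ` a probability measure,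
for swept-tube families `Sh` (window length `h`), `Sℓ` (length `ℓ`) with `vol ≤ 4 ε² · length · ‖u‖`: the probability that a
lift of `x_j − x_i` lies in `Sh (v_i − v_j)` AND a lift of `x_{j'} − x_i` lies in `Sℓ (v_{j'} − v_i) ∪ Sh (v_i − v_{j'})` is at most
`32 ε⁴ h (ℓ + h) · ∫ ‖q.2 − q.1‖² d(γ ⊗ γ)` (independence at fixed `(x_i, v_i)`, `prod_liftEvent_le`, `lintegral_norm_sub_mul_self_le`). -/
theorem measure_tripleLiftEvent_le (γ : Measure V3) [IsProbabilityMeasure γ] {ε h ℓ : ℝ} (hh : 0 ≤ h) (hℓ : 0 ≤ ℓ)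
    {Sh Sℓ : V3 → Set V3} (hShm : MeasurableSet {q : V3 × V3 | q.1 ∈ Sh q.2}) (hSℓm : MeasurableSet {q : V3 × V3 | q.1 ∈ Sℓ q.2})
    (hShvol : ∀ v, volume (Sh v) ≤ ENNReal.ofReal (4 * ε ^ 2 * h * ‖v‖))
    (hSℓvol : ∀ v, volume (Sℓ v) ≤ ENNReal.ofReal (4 * ε ^ 2 * ℓ * ‖v‖)) :
    (((volume : Measure T3).prod γ).prod (((volume : Measure T3).prod γ).prod ((volume : Measure T3).prod γ)))
        {q | (∃ k : Fin 3 → ℤ, Torus.reprSym (q.2.1.1 - q.1.1) + Torus.latticeVec k ∈ Sh (q.1.2 - q.2.1.2)) ∧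
          ∃ k : Fin 3 → ℤ, Torus.reprSym (q.2.2.1 - q.1.1) + Torus.latticeVec k ∈ Sℓ (q.2.2.2 - q.1.2) ∪ Sh (q.1.2 - q.2.2.2)} ≤
      ENNReal.ofReal (32 * ε ^ 4 * h * (ℓ + h)) * ∫⁻ q, ENNReal.ofReal (‖q.2 - q.1‖ ^ 2) ∂(γ.prod γ) := by
  set ref : Measure (T3 × V3) := (volume : Measure T3).prod γ with href
  set A : Set ((T3 × V3) × (T3 × V3) × (T3 × V3)) :=
    {q | (∃ k : Fin 3 → ℤ, Torus.reprSym (q.2.1.1 - q.1.1) + Torus.latticeVec k ∈ Sh (q.1.2 - q.2.1.2)) ∧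
      ∃ k : Fin 3 → ℤ, Torus.reprSym (q.2.2.1 - q.1.1) + Torus.latticeVec k ∈ Sℓ (q.2.2.2 - q.1.2) ∪ Sh (q.1.2 - q.2.2.2)} with hA
  -- the sections at fixed `q₁ = (x_i, v_i)`: a product of two lift events
  set B₁ : T3 × V3 → Set (T3 × V3) := fun q₁ =>
    {q₂ | ∃ k : Fin 3 → ℤ, Torus.reprSym (q₂.1 - q₁.1) + Torus.latticeVec k ∈ Sh (q₁.2 - q₂.2)} with hB₁
  set B₂ : T3 × V3 → Set (T3 × V3) := fun q₁ =>
    {q₃ | ∃ k : Fin 3 → ℤ, Torus.reprSym (q₃.1 - q₁.1) + Torus.latticeVec k ∈ Sℓ (q₃.2 - q₁.2) ∪ Sh (q₁.2 - q₃.2)} with hB₂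
  have hsec : ∀ q₁ : T3 × V3, Prod.mk q₁ ⁻¹' A = B₁ q₁ ×ˢ B₂ q₁ := fun q₁ => Set.ext fun _ => Iff.rfl
  set m₁ : V3 → ℝ≥0∞ := fun v₁ => ∫⁻ v, ENNReal.ofReal ‖v₁ - v‖ ∂γ with hm₁
  set m₂ : V3 → ℝ≥0∞ := fun v₁ => ∫⁻ v, ENNReal.ofReal (‖v₁ - v‖ ^ 2) ∂γ with hm₂
  have hB₁le : ∀ q₁ : T3 × V3, ref (B₁ q₁) ≤ ENNReal.ofReal (4 * ε ^ 2 * h) * m₁ q₁.2 := by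
    intro q₁
    have hT : MeasurableSet {q : V3 × V3 | q.1 ∈ Sh (q₁.2 - q.2)} :=
      hShm.preimage (measurable_fst.prodMk (measurable_const.sub measurable_snd))
    refine (prod_liftEvent_le γ q₁.1 (T := fun v => Sh (q₁.2 - v)) hT).trans ?_
    rw [hm₁, ← lintegral_const_mul' _ _ ENNReal.ofReal_ne_top]
    refine lintegral_mono fun v => (hShvol _).trans (le_of_eq ?_)
    rw [← ENNReal.ofReal_mul (by positivity)]
  have hB₂le : ∀ q₁ : T3 × V3, ref (B₂ q₁) ≤ ENNReal.ofReal (4 * ε ^ 2 * (ℓ + h)) * m₁ q₁.2 := by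
    intro q₁
    have hT : MeasurableSet {q : V3 × V3 | q.1 ∈ Sℓ (q.2 - q₁.2) ∪ Sh (q₁.2 - q.2)} :=
      (hSℓm.preimage (measurable_fst.prodMk (measurable_snd.sub measurable_const))).union
        (hShm.preimage (measurable_fst.prodMk (measurable_const.sub measurable_snd)))
    refine (prod_liftEvent_le γ q₁.1 (T := fun v => Sℓ (v - q₁.2) ∪ Sh (q₁.2 - v)) hT).trans ?_
    rw [hm₁, ← lintegral_const_mul' _ _ ENNReal.ofReal_ne_top]
    refine lintegral_mono fun v => (measure_union_le _ _).trans ((add_le_add (hSℓvol _) (hShvol _)).trans (le_of_eq ?_))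
    rw [norm_sub_rev v q₁.2, ← ENNReal.ofReal_add (by positivity) (by positivity), ← ENNReal.ofReal_mul (by positivity)]
    congr 1
    ring
  -- Gaussian bookkeeping: `∫ m₂(v_i) d(vol ⊗ γ) = ∫ ‖q.2 − q.1‖² d(γ ⊗ γ)`
  have hm₂m : Measurable m₂ :=
    Measurable.lintegral_prod_right' (f := fun q : V3 × V3 => ENNReal.ofReal (‖q.1 - q.2‖ ^ 2)) (by fun_prop)
  have hint : ∫⁻ q₁, m₂ q₁.2 ∂ref = ∫⁻ q, ENNReal.ofReal (‖q.2 - q.1‖ ^ 2) ∂(γ.prod γ) := by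
    calc ∫⁻ q₁, m₂ q₁.2 ∂ref = ∫⁻ _x : T3, ∫⁻ v₁, m₂ v₁ ∂γ ∂(volume : Measure T3) :=
          lintegral_prod (μ := (volume : Measure T3)) (ν := γ) (fun q : T3 × V3 => m₂ q.2) (hm₂m.comp measurable_snd).aemeasurable
      _ = ∫⁻ v₁, m₂ v₁ ∂γ := by rw [lintegral_const, measure_univ, mul_one]
      _ = ∫⁻ q, ENNReal.ofReal (‖q.1 - q.2‖ ^ 2) ∂(γ.prod γ) :=
          (lintegral_prod (μ := γ) (ν := γ) (fun q : V3 × V3 => ENNReal.ofReal (‖q.1 - q.2‖ ^ 2))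
            (by fun_prop : Measurable fun q : V3 × V3 => ENNReal.ofReal (‖q.1 - q.2‖ ^ 2)).aemeasurable).symm
      _ = ∫⁻ q, ENNReal.ofReal (‖q.2 - q.1‖ ^ 2) ∂(γ.prod γ) := lintegral_congr fun q => by rw [norm_sub_rev]
  -- assembly
  calc (ref.prod (ref.prod ref)) A = ∫⁻ q₁, (ref.prod ref) (Prod.mk q₁ ⁻¹' A) ∂ref := Measure.prod_apply (measurableSet_tripleLiftEvent hShm hSℓm)
    _ ≤ ∫⁻ q₁, ENNReal.ofReal (16 * ε ^ 4 * h * (ℓ + h)) * (2 * m₂ q₁.2) ∂ref := by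
        refine lintegral_mono fun q₁ => ?_
        rw [hsec q₁, Measure.prod_prod]
        calc ref (B₁ q₁) * ref (B₂ q₁)
            ≤ (ENNReal.ofReal (4 * ε ^ 2 * h) * m₁ q₁.2) * (ENNReal.ofReal (4 * ε ^ 2 * (ℓ + h)) * m₁ q₁.2) :=
              mul_le_mul' (hB₁le q₁) (hB₂le q₁)
          _ = ENNReal.ofReal (16 * ε ^ 4 * h * (ℓ + h)) * (m₁ q₁.2 * m₁ q₁.2) := by
              rw [show (16 : ℝ) * ε ^ 4 * h * (ℓ + h) = (4 * ε ^ 2 * h) * (4 * ε ^ 2 * (ℓ + h)) by ring,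
                ENNReal.ofReal_mul (by positivity : (0 : ℝ) ≤ 4 * ε ^ 2 * h)]
              ring
          _ ≤ ENNReal.ofReal (16 * ε ^ 4 * h * (ℓ + h)) * (2 * m₂ q₁.2) := mul_le_mul' le_rfl (lintegral_norm_sub_mul_self_le γ q₁.2)
    _ = ENNReal.ofReal (32 * ε ^ 4 * h * (ℓ + h)) * ∫⁻ q, ENNReal.ofReal (‖q.2 - q.1‖ ^ 2) ∂(γ.prod γ) := by
        rw [lintegral_const_mul' _ _ ENNReal.ofReal_ne_top, lintegral_const_mul' _ _ ENNReal.ofNat_ne_top, hint, ← mul_assoc,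
          show (32 : ℝ) * ε ^ 4 * h * (ℓ + h) = 16 * ε ^ 4 * h * (ℓ + h) * 2 by ring,
          ENNReal.ofReal_mul (by positivity : (0 : ℝ) ≤ 16 * ε ^ 4 * h * (ℓ + h)), ENNReal.ofReal_ofNat]

/-- **Window bound for the collision sum of the forward-contact count, non-stationary law.** For a hard-sphere flow `Φ` of
`N + 1` spheres of diameter `ε > 0` on `𝕋³`, a law `P` whose push-forwards `(Φ_t)_* P`, `t ∈ [0, τ]`, have three-particle
marginals dominated by `C · (vol ⊗ γ)^{⊗ 3}`, `γ = N(u, θ)` (the triple conjunct of the marginal envelope), and `0 < τ' ≤ τ`,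
`ℓ, η > 0`: the probability that a good orbit has `Σ_{collisions (s,i,j), s ∈ [0,τ']} #{j' ∉ {i,j} on a free collision course
with i within time ℓ} ≥ η` is at most `η⁻¹ · 64 C τ' ℓ (N+1)³ ε⁴ · ∫ ‖q.2 − q.1‖² d(γ ⊗ γ)` (rung-0 twin:
`localGibbsLaw_fwdHitCollisionSum_ge_le`; here `exists_measurable_majorant_collisionSum_of_forall_le` + `measure_tripleLiftEvent_le`). -/
theorem measure_fwdHitCollisionSum_ge_le_of_tripleEnvelope {ε : ℝ} (hε0 : 0 < ε) {N : ℕ}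
    (Φ : HardSphereFlow (Torus.geometry (Fin 3)) ε (N + 1)) (P : Measure (Config (N + 1) (Fin 3) T3)) {C : ℝ} (hC : 0 ≤ C)
    (u : V3) (θ : ℝ) {τ : ℝ}
    (htriple : ∀ t ∈ Icc (0 : ℝ) τ, ∀ i j k : Fin (N + 1), i ≠ j → i ≠ k → j ≠ k →
      ∀ f : (T3 × V3) × (T3 × V3) × (T3 × V3) → ℝ≥0∞, Measurable f →
        ∫⁻ z, f (Φ.flow t z i, Φ.flow t z j, Φ.flow t z k) ∂P ≤
          ENNReal.ofReal C * ∫⁻ q, f q ∂(((volume : Measure T3).prod (gaussMeasure u θ)).prod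
            (((volume : Measure T3).prod (gaussMeasure u θ)).prod ((volume : Measure T3).prod (gaussMeasure u θ)))))
    {τ' : ℝ} (hτ' : 0 < τ') (hτ'τ : τ' ≤ τ) {ℓ : ℝ} (hℓ : 0 < ℓ) {η : ℝ} (hη : 0 < η) :
    P {z | z ∈ Φ.good ∧ η ≤ ∑ᶠ s ∈ collisionTimes (Torus.geometry (Fin 3)) ε (fun t => Φ.flow t z) ∩ Icc 0 τ',
          ∑ i : Fin (N + 1), ∑ j : Fin (N + 1),
            (if i ≠ j ∧ ‖(Torus.geometry (Fin 3)).sepVec (Φ.flow s z i).1 (Φ.flow s z j).1‖ = ε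
              then (∑ j' : Fin (N + 1), if j' ≠ i ∧ j' ≠ j ∧ ∃ t ∈ Ioo 0 ℓ,
                ‖Torus.reprSym (((Φ.flow s z j').1 - (Φ.flow s z i).1) + Torus.proj (t • ((Φ.flow s z j').2 - (Φ.flow s z i).2)))‖ = ε
                then (1 : ℝ) else 0) else 0)} ≤
      (ENNReal.ofReal η)⁻¹ * (ENNReal.ofReal (64 * C * τ' * ℓ * ((N + 1 : ℕ) : ℝ) ^ 3 * ε ^ 4) *
        ∫⁻ q, ENNReal.ofReal (‖q.2 - q.1‖ ^ 2) ∂((gaussMeasure u θ).prod (gaussMeasure u θ))) := by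
  classical
  -- adapted from `localGibbsLaw_fwdHitCollisionSum_ge_le` (Literature/MathematicalPhysics/KineticTheory/ShortFlightCount)
  set γ : Measure V3 := gaussMeasure u θ with hγ
  set m₂ := ∫⁻ q, ENNReal.ofReal (‖q.2 - q.1‖ ^ 2) ∂(γ.prod γ) with hm₂
  set ref : Measure (T3 × V3) := (volume : Measure T3).prod γ with href
  -- tube families: length `ℓ`, and length `τ' / M` for every mesh
  obtain ⟨Sℓ, hSℓm, hSℓvol, hSℓ⟩ := exists_sweptTube hε0 hℓ.le
  have hhM : ∀ M : ℕ, 0 ≤ τ' / M := fun M => div_nonneg hτ'.le (Nat.cast_nonneg M)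
  choose Sh hShm hShvol hSh using fun M : ℕ => exists_sweptTube hε0 (hhM M)
  -- events, the three-label event in one-particle coordinates, mark, majorants
  set E : ℕ → Fin (N + 1) → Fin (N + 1) → Set (Config (N + 1) (Fin 3) T3) := fun M p m =>
    {w | ∃ k : Fin 3 → ℤ, Torus.reprSym ((w m).1 - (w p).1) + Torus.latticeVec k ∈ Sh M ((w p).2 - (w m).2)} with hEdef
  set E' : ℕ → Fin (N + 1) → Fin (N + 1) → Set (Config (N + 1) (Fin 3) T3) := fun M p j' =>
    {w | ∃ k : Fin 3 → ℤ, Torus.reprSym ((w j').1 - (w p).1) + Torus.latticeVec k ∈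
      Sℓ ((w j').2 - (w p).2) ∪ Sh M ((w p).2 - (w j').2)} with hE'def
  set A : ℕ → Set ((T3 × V3) × (T3 × V3) × (T3 × V3)) := fun M =>
    {q | (∃ k : Fin 3 → ℤ, Torus.reprSym (q.2.1.1 - q.1.1) + Torus.latticeVec k ∈ Sh M (q.1.2 - q.2.1.2)) ∧
      ∃ k : Fin 3 → ℤ, Torus.reprSym (q.2.2.1 - q.1.1) + Torus.latticeVec k ∈ Sℓ (q.2.2.2 - q.1.2) ∪ Sh M (q.1.2 - q.2.2.2)}
    with hAdef
  set F : Config (N + 1) (Fin 3) T3 → Fin (N + 1) → Fin (N + 1) → ℝ≥0∞ := fun w p m =>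
    ∑ j' : Fin (N + 1), if j' ≠ p ∧ j' ≠ m ∧ ∃ t ∈ Ioo 0 ℓ,
      ‖Torus.reprSym (((w j').1 - (w p).1) + Torus.proj (t • ((w j').2 - (w p).2)))‖ = ε then (1 : ℝ≥0∞) else 0 with hFdef
  set Ft : ℕ → Config (N + 1) (Fin 3) T3 → Fin (N + 1) → Fin (N + 1) → ℝ≥0∞ := fun M w p m =>
    ∑ j' : Fin (N + 1), if j' ≠ p ∧ j' ≠ m then (E M p m ∩ E' M p j').indicator 1 w else 0 with hFtdef
  -- measurability
  have hψm : ∀ (i j i' j'' : Fin (N + 1)) (k : Fin 3 → ℤ), Measurable fun w : Config (N + 1) (Fin 3) T3 =>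
      (Torus.reprSym ((w i).1 - (w j).1) + Torus.latticeVec k, (w i').2 - (w j'').2) := fun i j i' j'' k =>
    ((Torus.measurable_reprSym.comp ((measurable_pi_apply i).fst.sub (measurable_pi_apply j).fst)).add_const _).prodMk
      ((measurable_pi_apply i').snd.sub (measurable_pi_apply j'').snd)
  have hEm : ∀ M p m, MeasurableSet (E M p m) := fun M p m => by
    convert MeasurableSet.iUnion fun k => (hShm M).preimage (hψm m p p m k) using 1
    ext w; simp only [hEdef, mem_setOf_eq, mem_iUnion, mem_preimage]
  have hE'm : ∀ M p j', MeasurableSet (E' M p j') := fun M p j' => by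
    convert MeasurableSet.iUnion fun k => (hSℓm.preimage (hψm j' p j' p k)).union ((hShm M).preimage (hψm j' p p j' k)) using 1
    ext w; simp only [hE'def, mem_setOf_eq, mem_iUnion, mem_preimage, mem_union]
  have hsm : ∀ M p m j', Measurable fun w : Config (N + 1) (Fin 3) T3 =>
      (if j' ≠ p ∧ j' ≠ m then (E M p m ∩ E' M p j').indicator 1 w else 0 : ℝ≥0∞) := fun M p m j' =>
    Measurable.ite (MeasurableSet.const _) (measurable_one.indicator ((hEm M p m).inter (hE'm M p j'))) measurable_const
  have hFtm : ∀ M p m, Measurable fun w => Ft M w p m := fun M p m => Finset.measurable_sum _ fun j' _ => hsm M p m j'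
  have hAm : ∀ M, MeasurableSet (A M) := fun M => measurableSet_tripleLiftEvent (hShm M) hSℓm
  -- the pair-and-tube event read in the three one-particle coordinates
  have hind3 : ∀ (M : ℕ) (p m j' : Fin (N + 1)) (w : Config (N + 1) (Fin 3) T3),
      (E M p m ∩ E' M p j').indicator (1 : Config (N + 1) (Fin 3) T3 → ℝ≥0∞) w =
        (A M).indicator (fun _ => (1 : ℝ≥0∞)) (w p, w m, w j') := by
    intro M p m j' w
    by_cases hw : w ∈ E M p m ∩ E' M p j'
    · have hw' : (w p, w m, w j') ∈ A M := by simpa only [hAdef, hEdef, hE'def, mem_inter_iff, mem_setOf_eq] using hw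
      rw [indicator_of_mem hw, indicator_of_mem hw', Pi.one_apply]
    · have hw' : (w p, w m, w j') ∉ A M := by simpa only [hAdef, hEdef, hE'def, mem_inter_iff, mem_setOf_eq] using hw
      rw [indicator_of_notMem hw, indicator_of_notMem hw']
  -- covering property of the window events
  have hEc : ∀ (M : ℕ) (p m : Fin (N + 1)), p ≠ m → ∀ w ∈ hardSphereDomain (Torus.geometry (Fin 3)) (N + 1) ε,
      ∀ t ∈ Icc 0 (τ' / M), ‖(Torus.geometry (Fin 3)).sepVec ((freeFlight (Torus.geometry (Fin 3)) (-t) w p).1)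
        ((freeFlight (Torus.geometry (Fin 3)) (-t) w m).1)‖ = ε → w ∈ E M p m := by
    intro M p m hpm w hw t ht hc
    rw [Torus.norm_geometry_sepVec, Torus.euclidDist_comm, ← Torus.norm_geometry_sepVec] at hc
    exact exists_latticeVec_add_mem_of_contact (hSh M) hw hpm.symm ht hc
  -- the majorants dominate the mark along the window
  have hFt : ∀ (M : ℕ) (p m : Fin (N + 1)), p ≠ m → ∀ w ∈ hardSphereDomain (Torus.geometry (Fin 3)) (N + 1) ε,
      ∀ t ∈ Icc 0 (τ' / M), ‖(Torus.geometry (Fin 3)).sepVec ((freeFlight (Torus.geometry (Fin 3)) (-t) w p).1)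
        ((freeFlight (Torus.geometry (Fin 3)) (-t) w m).1)‖ = ε → F (freeFlight (Torus.geometry (Fin 3)) (-t) w) p m ≤ Ft M w p m := by
    intro M p m hpm w hw t ht hc
    refine Finset.sum_le_sum fun j' _ => ?_
    by_cases hcond : j' ≠ p ∧ j' ≠ m ∧ ∃ t' ∈ Ioo 0 ℓ,
        ‖Torus.reprSym ((((freeFlight (Torus.geometry (Fin 3)) (-t) w) j').1 - ((freeFlight (Torus.geometry (Fin 3)) (-t) w) p).1) +
          Torus.proj (t' • (((freeFlight (Torus.geometry (Fin 3)) (-t) w) j').2 -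
            ((freeFlight (Torus.geometry (Fin 3)) (-t) w) p).2)))‖ = ε
    · obtain ⟨hj'p, hj'm, t', ht', hhit⟩ := hcond
      rw [if_pos ⟨hj'p, hj'm, t', ht', hhit⟩, if_pos ⟨hj'p, hj'm⟩]
      have hmem : w ∈ E M p m ∩ E' M p j' :=
        ⟨hEc M p m hpm w hw t ht hc, exists_latticeVec_mem_twoSidedTube (hSh M) hSℓ hw hj'p ht ht' hhit⟩
      rw [indicator_of_mem hmem, Pi.one_apply]
    · rw [if_neg hcond]
      exact bot_le
  -- the one-window bound under the laws at the times of the window: the triple envelope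
  set n : ℝ≥0∞ := ((N + 1 : ℕ) : ℝ≥0∞) with hn
  set c : ℕ → ℝ≥0∞ := fun M => ENNReal.ofReal (C * (32 * ε ^ 4 * (τ' / M) * (ℓ + τ' / M))) * m₂ with hc
  set B : ℕ → ℝ≥0∞ := fun M => n * (n * (n * c M)) with hB
  have hBle : ∀ (M : ℕ), ∀ r ∈ Icc (0 : ℝ) (0 + τ'),
      ∫⁻ w, ∑ p, ∑ m, (if p ≠ m then (E M p m).indicator (fun w => Ft M w p m) w else 0) ∂(P.map (Φ.flow r)) ≤ B M := by
    intro M r hr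
    rw [zero_add] at hr
    have hrτ : r ∈ Icc (0 : ℝ) τ := ⟨hr.1, hr.2.trans hτ'τ⟩
    -- one ordered triple: change of variables `lintegral_map_le`, the triple envelope, the statics
    have hatom : ∀ p m j' : Fin (N + 1), p ≠ m → j' ≠ p → j' ≠ m →
        ∫⁻ w, (E M p m ∩ E' M p j').indicator 1 w ∂(P.map (Φ.flow r)) ≤ c M := by
      intro p m j' hpm hj'p hj'm
      calc ∫⁻ w, (E M p m ∩ E' M p j').indicator 1 w ∂(P.map (Φ.flow r))
          = ∫⁻ w, (A M).indicator (fun _ => (1 : ℝ≥0∞)) (w p, w m, w j') ∂(P.map (Φ.flow r)) := lintegral_congr fun w => hind3 M p m j' w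
        _ ≤ ∫⁻ z, (A M).indicator (fun _ => (1 : ℝ≥0∞)) (Φ.flow r z p, Φ.flow r z m, Φ.flow r z j') ∂P :=
            lintegral_map_le (fun w : Config (N + 1) (Fin 3) T3 => (A M).indicator (fun _ => (1 : ℝ≥0∞)) (w p, w m, w j')) (Φ.flow r)
        _ ≤ ENNReal.ofReal C * ∫⁻ q, (A M).indicator (fun _ => (1 : ℝ≥0∞)) q ∂(ref.prod (ref.prod ref)) :=
            htriple r hrτ p m j' hpm hj'p.symm hj'm.symm _ (measurable_const.indicator (hAm M))
        _ = ENNReal.ofReal C * (ref.prod (ref.prod ref)) (A M) := by rw [lintegral_indicator_const (hAm M), one_mul]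
        _ ≤ ENNReal.ofReal C * (ENNReal.ofReal (32 * ε ^ 4 * (τ' / M) * (ℓ + τ' / M)) * m₂) :=
            mul_le_mul' le_rfl (measure_tripleLiftEvent_le γ (hhM M) hℓ.le (hShm M) hSℓm (hShvol M) hSℓvol)
        _ = c M := by rw [hc, ← mul_assoc, ← ENNReal.ofReal_mul hC]
    -- one ordered pair
    have hterm : ∀ p m : Fin (N + 1),
        ∫⁻ w, (if p ≠ m then (E M p m).indicator (fun w => Ft M w p m) w else 0) ∂(P.map (Φ.flow r)) ≤ n * c M := by
      intro p m
      by_cases hpm : p ≠ m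
      · simp only [if_pos hpm]
        calc ∫⁻ w, (E M p m).indicator (fun w => Ft M w p m) w ∂(P.map (Φ.flow r))
            ≤ ∫⁻ w, Ft M w p m ∂(P.map (Φ.flow r)) := lintegral_mono fun w => Set.indicator_le_self _ _ w
          _ = ∑ j' : Fin (N + 1), ∫⁻ w, (if j' ≠ p ∧ j' ≠ m then (E M p m ∩ E' M p j').indicator 1 w else 0 : ℝ≥0∞)
                ∂(P.map (Φ.flow r)) := lintegral_finsetSum _ fun j' _ => hsm M p m j'
          _ ≤ ∑ _j' : Fin (N + 1), c M := by
              refine Finset.sum_le_sum fun j' _ => ?_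
              by_cases hj : j' ≠ p ∧ j' ≠ m
              · simp only [if_pos hj]; exact hatom p m j' hpm hj.1 hj.2
              · simp only [if_neg hj, lintegral_zero]; exact bot_le
          _ = n * c M := by rw [Finset.sum_const, Finset.card_univ, Fintype.card_fin, nsmul_eq_mul]
      · simp only [if_neg hpm, lintegral_zero]; exact bot_le
    have hmeas : ∀ p m : Fin (N + 1), Measurable fun w : Config (N + 1) (Fin 3) T3 =>
        (if p ≠ m then (E M p m).indicator (fun w => Ft M w p m) w else 0) := fun p m =>
      Measurable.ite (MeasurableSet.const _) ((hFtm M p m).indicator (hEm M p m)) measurable_const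
    calc ∫⁻ w, ∑ p, ∑ m, (if p ≠ m then (E M p m).indicator (fun w => Ft M w p m) w else 0) ∂(P.map (Φ.flow r))
        = ∑ p, ∑ m, ∫⁻ w, (if p ≠ m then (E M p m).indicator (fun w => Ft M w p m) w else 0) ∂(P.map (Φ.flow r)) := by
          rw [lintegral_finsetSum _ fun p _ => Finset.measurable_sum _ fun m _ => hmeas p m]
          exact Finset.sum_congr rfl fun p _ => lintegral_finsetSum _ fun m _ => hmeas p m
      _ ≤ ∑ _p : Fin (N + 1), ∑ _m : Fin (N + 1), n * c M := Finset.sum_le_sum fun p _ => Finset.sum_le_sum fun m _ => hterm p m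
      _ = B M := by simp only [Finset.sum_const, Finset.card_univ, Fintype.card_fin, nsmul_eq_mul, hB, hn]
  -- the non-stationary window device: a measurable majorant of the collision sum over `[0, τ']`
  obtain ⟨g, hgm, hdom, hint⟩ := exists_measurable_majorant_collisionSum_of_forall_le Φ P hτ' 0 F E hEm hEc Ft hFtm hFt B hBle
  simp only [zero_add] at hdom
  -- `liminf_M M · B M ≤ 64 C τ' ℓ (N+1)³ ε⁴ m₂`: the mesh cancels
  set L : ℝ≥0∞ := ENNReal.ofReal (64 * C * τ' * ℓ * ((N + 1 : ℕ) : ℝ) ^ 3 * ε ^ 4) * m₂ with hL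
  have hMB : ∀ M : ℕ, 0 < M → τ' / M ≤ ℓ → (M : ℝ≥0∞) * B M ≤ L := by
    intro M hM hMℓ
    have hM' : (0 : ℝ) < M := by exact_mod_cast hM
    have hBM : (M : ℝ≥0∞) * B M = ENNReal.ofReal ((M : ℝ) * ((N + 1 : ℕ) : ℝ) * ((N + 1 : ℕ) : ℝ) * ((N + 1 : ℕ) : ℝ) *
        (C * (32 * ε ^ 4 * (τ' / M) * (ℓ + τ' / M)))) * m₂ := by
      simp only [hB, hc, hn]
      rw [← ENNReal.ofReal_natCast M, ← ENNReal.ofReal_natCast (N + 1), ← mul_assoc, ← mul_assoc, ← mul_assoc, ← mul_assoc,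
        ← ENNReal.ofReal_mul (Nat.cast_nonneg _), ← ENNReal.ofReal_mul (by positivity), ← ENNReal.ofReal_mul (by positivity),
        ← ENNReal.ofReal_mul (by positivity)]
    rw [hBM, hL]
    refine mul_le_mul_of_nonneg_right (ENNReal.ofReal_le_ofReal ?_) bot_le
    have hMτ : (M : ℝ) * (τ' / M) = τ' := by field_simp
    calc (M : ℝ) * ((N + 1 : ℕ) : ℝ) * ((N + 1 : ℕ) : ℝ) * ((N + 1 : ℕ) : ℝ) * (C * (32 * ε ^ 4 * (τ' / M) * (ℓ + τ' / M)))
        = 32 * C * ((M : ℝ) * (τ' / M)) * ((N + 1 : ℕ) : ℝ) ^ 3 * ε ^ 4 * (ℓ + τ' / M) := by ring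
      _ ≤ 32 * C * τ' * ((N + 1 : ℕ) : ℝ) ^ 3 * ε ^ 4 * (ℓ + ℓ) := by rw [hMτ]; gcongr
      _ = 64 * C * τ' * ℓ * ((N + 1 : ℕ) : ℝ) ^ 3 * ε ^ 4 := by ring
  have hfreq : ∃ᶠ M : ℕ in atTop, (M : ℝ≥0∞) * B M ≤ L := by
    refine Eventually.frequently ?_
    filter_upwards [eventually_ge_atTop 1, (tendsto_natCast_atTop_atTop (R := ℝ)).eventually_ge_atTop (τ' / ℓ)] with M hM1 hM2
    rw [div_le_iff₀ hℓ] at hM2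
    exact hMB M hM1 ((div_le_iff₀ (by exact_mod_cast hM1 : (0 : ℝ) < M)).2 (by linarith))
  -- Markov for the majorant; the real collision sum is the `ℝ≥0∞` one on the good set
  have hη0 : ENNReal.ofReal η ≠ 0 := (ENNReal.ofReal_pos.2 hη).ne'
  refine (measure_mono (t := {z | ENNReal.ofReal η ≤ g z}) fun z hz => ?_).trans ?_
  · obtain ⟨hz, hle⟩ := hz
    refine (?_ : ENNReal.ofReal η ≤ _).trans (hdom z hz)
    have hfin := (Φ.isTrajectory z hz).locFinite 0 τ'
    rw [finsum_mem_eq_finite_toFinset_sum _ hfin] at hle ⊢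
    refine (ENNReal.ofReal_le_ofReal hle).trans (le_of_eq ?_)
    rw [ENNReal.ofReal_sum_of_nonneg fun s _ => by positivity]
    refine Finset.sum_congr rfl fun s _ => ?_
    rw [ENNReal.ofReal_sum_of_nonneg fun i _ => by positivity]
    refine Finset.sum_congr rfl fun i _ => ?_
    rw [ENNReal.ofReal_sum_of_nonneg fun j _ => by positivity]
    refine Finset.sum_congr rfl fun j _ => ?_
    by_cases hcs : i ≠ j ∧ ‖(Torus.geometry (Fin 3)).sepVec (Φ.flow s z i).1 (Φ.flow s z j).1‖ = ε
    · rw [if_pos hcs, if_pos hcs, hFdef]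
      dsimp only
      rw [ENNReal.ofReal_sum_of_nonneg fun j' _ => by positivity]
      exact Finset.sum_congr rfl fun j' _ => by split_ifs <;> simp
    · rw [if_neg hcs, if_neg hcs, ENNReal.ofReal_zero]
  · calc P {z | ENNReal.ofReal η ≤ g z} ≤ (∫⁻ z, g z ∂P) / ENNReal.ofReal η :=
          meas_ge_le_lintegral_div hgm.aemeasurable hη0 ENNReal.ofReal_ne_top
      _ = (ENNReal.ofReal η)⁻¹ * ∫⁻ z, g z ∂P := by rw [ENNReal.div_eq_inv_mul]
      _ ≤ (ENNReal.ofReal η)⁻¹ * L := by gcongr; exact hint.trans (liminf_le_of_frequently_le' hfreq)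

/-- **F3 · the forward-contact collision-flux bound under the evolved local Gibbs law, from the marginal envelope (A)** (registered stub `stub_fwdHitFluxLG_of_envelope` of crux stmt-AtomisticToContinuum-13481, line `Sketch`, skeleton v21): general-profile twin of `localGibbsLaw_fwdHitCollisionSum_ge_le` with the stationarity step replaced by `exists_measurable_majorant_collisionSum_of_forall_le` and the three-label one-window statics supplied by the triple conjunct of (A). [folklore] -/
theorem stub_fwdHitFluxLG_of_envelope :
    (∀ (a₀ θ₀ : T3 → ℝ) (u₀ : T3 → V3), Continuous a₀ → Continuous θ₀ → Continuous u₀ →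
      (∀ x, 0 < a₀ x) → (∀ x, 0 < θ₀ x) → ∃ σ₀ : ℝ, 0 < σ₀ ∧ ∀ σ : ℝ, 0 < σ → σ < σ₀ →
      ∀ Φ : (N : ℕ) → HardSphereFlow (Torus.geometry (Fin 3)) (hsDiameter σ N) (N + 1),
      ∀ τ : ℝ, 0 < τ → ∃ C : ℝ, 0 ≤ C ∧ ∃ u : V3, ∃ θ : ℝ, 0 < θ ∧ ∃ N₀ : ℕ, ∀ N : ℕ, N₀ ≤ N →
      ∀ t ∈ Set.Icc (0 : ℝ) τ,
        (∀ i j : Fin (N + 1), i ≠ j → ∀ f : (T3 × V3) × (T3 × V3) → ℝ≥0∞, Measurable f →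
          ∫⁻ z, f ((Φ N).flow t z i, (Φ N).flow t z j) ∂(localGibbsLaw σ a₀ u₀ θ₀ N (Φ N)) ≤
            ENNReal.ofReal C * ∫⁻ q, f q ∂(((volume : Measure T3).prod (gaussMeasure u θ)).prod
              ((volume : Measure T3).prod (gaussMeasure u θ)))) ∧
        (∀ i j k : Fin (N + 1), i ≠ j → i ≠ k → j ≠ k → ∀ f : (T3 × V3) × (T3 × V3) × (T3 × V3) → ℝ≥0∞, Measurable f →
          ∫⁻ z, f ((Φ N).flow t z i, (Φ N).flow t z j, (Φ N).flow t z k) ∂(localGibbsLaw σ a₀ u₀ θ₀ N (Φ N)) ≤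
            ENNReal.ofReal C * ∫⁻ q, f q ∂(((volume : Measure T3).prod (gaussMeasure u θ)).prod
              (((volume : Measure T3).prod (gaussMeasure u θ)).prod ((volume : Measure T3).prod (gaussMeasure u θ)))))) →
    ∀ (a₀ θ₀ : T3 → ℝ) (u₀ : T3 → V3), Continuous a₀ → Continuous θ₀ → Continuous u₀ →
      (∀ x, 0 < a₀ x) → (∀ x, 0 < θ₀ x) → ∃ σ₀ : ℝ, 0 < σ₀ ∧ ∀ σ : ℝ, 0 < σ → σ < σ₀ →
      ∀ Φ : (N : ℕ) → HardSphereFlow (Torus.geometry (Fin 3)) (hsDiameter σ N) (N + 1),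
      ∀ τ : ℝ, 0 < τ → ∃ C : ℝ, 0 ≤ C ∧ ∃ u : V3, ∃ θ : ℝ, 0 < θ ∧ ∃ N₀ : ℕ, ∀ N : ℕ, N₀ ≤ N →
      ∀ τ' : ℝ, 0 < τ' → τ' ≤ τ → ∀ ℓ : ℝ, 0 < ℓ → ∀ η : ℝ, 0 < η →
        localGibbsLaw σ a₀ u₀ θ₀ N (Φ N)
            {z | z ∈ (Φ N).good ∧ η ≤ ∑ᶠ s ∈ collisionTimes (Torus.geometry (Fin 3)) (hsDiameter σ N)
                (fun t => (Φ N).flow t z) ∩ Set.Icc 0 τ',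
              ∑ i : Fin (N + 1), ∑ j : Fin (N + 1),
                (if i ≠ j ∧ ‖(Torus.geometry (Fin 3)).sepVec ((Φ N).flow s z i).1 ((Φ N).flow s z j).1‖ = hsDiameter σ N
                  then (∑ j' : Fin (N + 1), if j' ≠ i ∧ j' ≠ j ∧ ∃ t ∈ Set.Ioo 0 ℓ,
                    ‖Torus.reprSym ((((Φ N).flow s z j').1 - ((Φ N).flow s z i).1) +
                      Literature.Analysis.FunctionSpaces.Torus.proj (t • (((Φ N).flow s z j').2 - ((Φ N).flow s z i).2)))‖ = hsDiameter σ N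
                    then (1 : ℝ) else 0) else 0)} ≤
          (ENNReal.ofReal η)⁻¹ * (ENNReal.ofReal (C * τ' * ℓ * ((N + 1 : ℕ) : ℝ) ^ 3 * hsDiameter σ N ^ 4) *
            ∫⁻ q, ENNReal.ofReal (‖q.2 - q.1‖ ^ 2) ∂((gaussMeasure u θ).prod (gaussMeasure u θ))) := by
  intro hA a₀ θ₀ u₀ ha hθ hu ha0 hθ0
  obtain ⟨σ₀, hσ₀, hAσ⟩ := hA a₀ θ₀ u₀ ha hθ hu ha0 hθ0
  refine ⟨σ₀, hσ₀, fun σ hσ hσσ₀ Φ τ hτ => ?_⟩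
  obtain ⟨C, hC, u, θ, hθ', N₀, hN⟩ := hAσ σ hσ hσσ₀ Φ τ hτ
  refine ⟨64 * C, by positivity, u, θ, hθ', N₀, fun N hNN τ' hτ' hτ'τ ℓ hℓ η hη => ?_⟩
  exact measure_fwdHitCollisionSum_ge_le_of_tripleEnvelope (hsDiameter_pos hσ N) (Φ N)
    (localGibbsLaw σ a₀ u₀ θ₀ N (Φ N)) hC u θ (fun t ht => (hN N hNN t ht).2) hτ' hτ'τ hℓ hη

end Summit.AtomisticToContinuum.HydrodynamicLimit.Theorems.CollisionRate
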